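import Summits.ResolutionOfSingularities.ResolutionOfSingularities.Theorems.EquisingularLiftEquisingularLiftNatClusterLift
import Mathlib
import HarnessLib

/-!
# [OURS · L1 W4.5(b)] T-CLUSTER-LIFT part 2 — ONE FAT POINT IS NEVER SUPERABUNDANT: the Taylor-jet map of order `< m` at a single
# point (any position, any chart) is onto on the forms of every degree `d ≥ m − 1`; hence the one-point lift of order `≥ m` along
# ANY section exists unconditionally (crux `EquisingularLiftNat` = stmt-ResolutionOfSingularities-20038, line `sections`; rungs v7/v7′)

NOT a statement of any manuscript. Helper file of the chain res-L1-w45b (cell `res-hironaka`, LADDER-RESOLUTION rung L, slot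
W4.5(b)); OURS; AI-written, weaker than expert review; `--supports stmt-ResolutionOfSingularities-20038 --as helper` by
res-L1-w45b-stub-3 (object T-CLUSTER-LIFT, part 2). No `sorry`; standard axioms.

WHAT. Part 1 (…NatClusterLift, `exists_isHomogeneous_lift_forall_dehomogenize_mem_pow`) lifts a degree-`d` form through a cluster
of sections under the downstairs INDEPENDENCE hypothesis `hind` («the cluster imposes independent conditions on degree-`d` forms»).
This file DISCHARGES `hind` in the base case of res-L1-w45b-tri-1's list (XDERIVE-M1 Y3(ii): «a fat point of multiplicity `m` imposes
independent conditions in degree `≥ m − 1`»):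

* `dehomogenize_X_self`, `dehomogenize_X_val` — `T_i ↦ 1`, `T_j ↦ X_j` under `Literature…Resolution.dehomogenize i`;
* `aeval_X_add_C_dehomogenize_jetForm` — for the explicit form `jetForm := Σ_{|α| < m} v_α · T_i^{d−|α|} · ∏_{j ≠ i} (T_j − a_j T_i)^{α_j}`
  (written inline, no definition is introduced): `jetForm(T_i := 1)(X + a) = Σ_{|α| < m} v_α X^α`;
* **`exists_isHomogeneous_forall_coeff_eq_onePoint`** — ONE POINT, ANY POSITION: for `m ≤ d + 1`, a chart `i`, affine coordinates
  `a : {j ≠ i} → k` and ANY prescribed jet `v : ({j ≠ i} →₀ ℕ) → k` there is a form `g ∈ k[T_σ]_d` whose jet of order `< m` at the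
  point is `v` (`coeff_α (g(T_i := 1)(X + a)) = v α` for `|α| < m`) — i.e. part 1's `hind` holds for a one-point cluster;
* **`exists_isHomogeneous_lift_dehomogenize_mem_pow_onePoint`** — hence (part 1 headline with `ι = Unit`): `π : O ↠ k`,
  `ker π ≤ jacobson ⊥`, `m ≤ d + 1`, ANY `O`-point `a` on the chart `i` and a degree-`d` form `g` over `k` with `g(T_i := 1) ∈ 𝔪_{ā}^m`
  ⇒ a degree-`d` form `G` over `O` with `map π G = g` and `G(T_i := 1) ∈ 𝔪_a^m`: the ONE-POINT LIFT OF ORDER `≥ m` ALONG ANY SECTION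
  lifting the point, with no coordinate change (res-L1-w45b-lead-2 DESIGN v6/v7 (TC⁺) «`G̃` := the lift CENTRED at the sectioned
  singular point»; res-L1-w45b-stub-1's T-ΔLIFT-CENTRED p523916 is the coordinate-vertex version `q = [1:0:0]` WITH Δ-genericity —
  this file has no genericity clause and any position); `…_of_isLocalRing` spelling.

Not treated: two or more points (the first genuinely conditional case of part 1: independence in degree `d ≥ m₁ + m₂ − 1`), Δ-genericity.

References: part 1 (…NatClusterLift); `Literature.AlgebraicGeometry.Resolution.dehomogenize`. res-L1-w45b-tri-1 XDERIVE-M1-DELTAJUNCTION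
b5629e966fb70e6a Y3(ii); res-L1-w45b-lead-2 LEAD-MEMO-5 §A (OURS planning texts, index only).
-/

set_option linter.dupNamespace false -- mandated namespace `Summit.<Summit>.<Problem>` of this single-conjunct summit

noncomputable section

open MvPolynomial Literature.AlgebraicGeometry.Resolution

namespace Summit.ResolutionOfSingularities.ResolutionOfSingularities.Theorems.EquisingularLiftNat.ClusterLift

/-! ## Dehomogenization on variables -/

section Dehom

variable {R : Type*} [CommRing R] {σ : Type*} [DecidableEq σ] (i : σ)

/-- `T_i ↦ 1`. [folklore] -/
theorem dehomogenize_X_self : dehomogenize i (X i : MvPolynomial σ R) = 1 := by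
  rw [aeval_X, killVar_self]

/-- `T_j ↦ X_j` for `j ≠ i`. [folklore] -/
theorem dehomogenize_X_val (j : {j : σ // j ≠ i}) : dehomogenize i (X j.1 : MvPolynomial σ R) = X j := by
  rw [aeval_X, killVar_of_ne i j.2]

end Dehom

/-! ## The explicit jet form and its Taylor coefficients -/

section Jet

variable {k : Type*} [CommRing k] {σ : Type*} [DecidableEq σ] (i : σ)

/-- **The jet form dehomogenized and shifted.** For the explicit form
`Σ_{α ∈ S} v_α · T_i^{d−|α|} · ∏_{j ≠ i} (T_j − a_j T_i)^{α_j}` one has `(…)(T_i := 1)(X + a) = Σ_{α ∈ S} v_α X^α`. [OURS · L1 W4.5b] -/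
theorem aeval_X_add_C_dehomogenize_jetForm [Fintype {j : σ // j ≠ i}] (a : {j : σ // j ≠ i} → k) (d : ℕ)
    (S : Finset ({j : σ // j ≠ i} →₀ ℕ)) (v : ({j : σ // j ≠ i} →₀ ℕ) → k) :
    aeval (fun j => (X j : MvPolynomial {j : σ // j ≠ i} k) + C (a j))
      (dehomogenize i (∑ α ∈ S, C (v α) * X i ^ (d - α.degree) *
        ∏ j : {j : σ // j ≠ i}, ((X j.1 : MvPolynomial σ k) - C (a j) * X i) ^ (α j)))
      = ∑ α ∈ S, monomial α (v α) := by
  rw [map_sum, map_sum]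
  refine Finset.sum_congr rfl fun α _ => ?_
  simp only [map_mul, map_pow, map_prod, map_sub, algHom_C, dehomogenize_X_self, dehomogenize_X_val]
  simp only [aeval_X, map_one, one_pow, mul_one, MvPolynomial.algebraMap_eq, algHom_C, add_sub_cancel_right]
  rw [MvPolynomial.monomial_eq, Finsupp.prod_fintype]
  intro j; exact pow_zero _

/-- **ONE FAT POINT IS NEVER SUPERABUNDANT (in degree `d ≥ m − 1`).** For a chart `i`, affine coordinates `a : {j ≠ i} → k` of a
point and `m ≤ d + 1`: every jet `v` of order `< m` at the point is the jet of a degree-`d` FORM `g ∈ k[T_σ]`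
(`coeff_α (g(T_i := 1)(X + a)) = v α` for all `|α| < m`) — part 1's INDEPENDENCE hypothesis `hind` for a one-point cluster.
(res-L1-w45b-tri-1 XDERIVE-M1 Y3(ii).) [folklore] [OURS · L1 W4.5b] -/
theorem exists_isHomogeneous_forall_coeff_eq_onePoint [Finite σ] (a : {j : σ // j ≠ i} → k) {m d : ℕ} (hmd : m ≤ d + 1)
    (v : ({j : σ // j ≠ i} →₀ ℕ) → k) :
    ∃ g : MvPolynomial σ k, g.IsHomogeneous d ∧
      ∀ α : {j : σ // j ≠ i} →₀ ℕ, α.degree < m →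
        coeff α (aeval (fun j => (X j : MvPolynomial {j : σ // j ≠ i} k) + C (a j)) (dehomogenize i g)) = v α := by
  classical
  haveI : Fintype {j : σ // j ≠ i} := Fintype.ofFinite _
  haveI : Fintype {α : {j : σ // j ≠ i} →₀ ℕ // α.degree < m} := @Fintype.ofFinite _ (finite_subtype_degree_lt m)
  -- the finite set of exponents of degree `< m`
  let S : Finset ({j : σ // j ≠ i} →₀ ℕ) :=
    Finset.univ.map (Function.Embedding.subtype fun α : {j : σ // j ≠ i} →₀ ℕ => α.degree < m)
  have hS : ∀ α : {j : σ // j ≠ i} →₀ ℕ, α ∈ S ↔ α.degree < m := by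
    intro α
    simp only [S, Finset.mem_map, Finset.mem_univ, Function.Embedding.coe_subtype, true_and, Subtype.exists,
      exists_prop, exists_eq_right]
  refine ⟨∑ α ∈ S, C (v α) * X i ^ (d - α.degree) *
      ∏ j : {j : σ // j ≠ i}, ((X j.1 : MvPolynomial σ k) - C (a j) * X i) ^ (α j), ?_, fun β hβ => ?_⟩
  · -- homogeneity of degree `d`
    refine IsHomogeneous.sum _ _ _ fun α hα => ?_
    have hαd : α.degree ≤ d := by have := (hS α).mp hα; omega
    have h1 : ∀ j : {j : σ // j ≠ i}, ((X j.1 : MvPolynomial σ k) - C (a j) * X i).IsHomogeneous 1 := fun j =>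
      (isHomogeneous_X k j.1).sub (by simpa using (isHomogeneous_C σ (a j)).mul (isHomogeneous_X k i))
    have hprod : (∏ j : {j : σ // j ≠ i}, ((X j.1 : MvPolynomial σ k) - C (a j) * X i) ^ (α j)).IsHomogeneous
        (∑ j : {j : σ // j ≠ i}, α j) := by
      refine IsHomogeneous.prod _ _ _ fun j _ => ?_
      simpa using (h1 j).pow (α j)
    have h := ((isHomogeneous_C σ (v α)).mul (isHomogeneous_X_pow (R := k) i (d - α.degree))).mul hprod
    rwa [zero_add, ← Finsupp.degree_eq_sum, Nat.sub_add_cancel hαd] at h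
  · -- the jet
    rw [aeval_X_add_C_dehomogenize_jetForm, coeff_sum]
    simp only [coeff_monomial]
    rw [Finset.sum_ite_eq' S β v, if_pos ((hS β).mpr hβ)]

end Jet

/-! ## The one-point lift along any section -/

section OnePoint

variable {O k : Type*} [CommRing O] [CommRing k] (π : O →+* k) {σ : Type*} [Finite σ] [DecidableEq σ]

/-- **THE ONE-POINT LIFT OF ORDER `≥ m` ALONG ANY SECTION.** `π : O ↠ k`, `ker π ≤ jacobson ⊥`; `m ≤ d + 1`; `a : {j ≠ i} → O` the
affine coordinates of an `O`-point (a section) on the chart `i`; `g ∈ k[T_σ]` a form of degree `d` of order `≥ m` at the reduced point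
(`g(T_i := 1) ∈ 𝔪_{ā}^m`). THEN there is a form `G ∈ O[T_σ]_d` with `map π G = g` and `G(T_i := 1) ∈ 𝔪_a^m` — `V(G)` has order
`≥ m` along the section; no genericity, no coordinate change, any position of the point. (Part 1 headline with `ι = Unit` and
`exists_isHomogeneous_forall_coeff_eq_onePoint`.) [OURS · L1 W4.5b] -/
theorem exists_isHomogeneous_lift_dehomogenize_mem_pow_onePoint (hπ : Function.Surjective π)
    (hker : RingHom.ker π ≤ (⊥ : Ideal O).jacobson) {d m : ℕ} (hmd : m ≤ d + 1) (i : σ)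
    (a : {j : σ // j ≠ i} → O) (g : MvPolynomial σ k) (hg : g.IsHomogeneous d)
    (hgq : dehomogenize i g ∈ (Ideal.span (Set.range fun j => (X j : MvPolynomial {j : σ // j ≠ i} k) - C (π (a j)))) ^ m) :
    ∃ G : MvPolynomial σ O, G.IsHomogeneous d ∧ MvPolynomial.map π G = g ∧
      dehomogenize i G ∈ (Ideal.span (Set.range fun j => (X j : MvPolynomial {j : σ // j ≠ i} O) - C (a j))) ^ m := by
  obtain ⟨G, hG, hGg, hGa⟩ := exists_isHomogeneous_lift_forall_dehomogenize_mem_pow π hπ hker (ι := Unit)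
    (fun _ => i) (fun _ => a) (fun _ => m)
    (fun v => by
      obtain ⟨g₁, hg₁, h⟩ := exists_isHomogeneous_forall_coeff_eq_onePoint i (fun j => π (a j)) hmd (v ())
      exact ⟨g₁, hg₁, fun t α hα => h α hα⟩)
    g hg (fun _ => hgq)
  exact ⟨G, hG, hGg, hGa ()⟩

/-- **The one-point lift over a local ring** (the chain's DVR `O` with residue map `π`). [OURS · L1 W4.5b] -/
theorem exists_isHomogeneous_lift_dehomogenize_mem_pow_onePoint_of_isLocalRing [IsLocalRing O] [Nontrivial k]
    (hπ : Function.Surjective π) {d m : ℕ} (hmd : m ≤ d + 1) (i : σ)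
    (a : {j : σ // j ≠ i} → O) (g : MvPolynomial σ k) (hg : g.IsHomogeneous d)
    (hgq : dehomogenize i g ∈ (Ideal.span (Set.range fun j => (X j : MvPolynomial {j : σ // j ≠ i} k) - C (π (a j)))) ^ m) :
    ∃ G : MvPolynomial σ O, G.IsHomogeneous d ∧ MvPolynomial.map π G = g ∧
      dehomogenize i G ∈ (Ideal.span (Set.range fun j => (X j : MvPolynomial {j : σ // j ≠ i} O) - C (a j))) ^ m :=
  exists_isHomogeneous_lift_dehomogenize_mem_pow_onePoint π hπ (ker_le_jacobson_bot_of_isLocalRing π) hmd i a g hg hgq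

end OnePoint

end Summit.ResolutionOfSingularities.ResolutionOfSingularities.Theorems.EquisingularLiftNat.ClusterLift

end
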